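import Literature.NumberTheory.LFunctions.ZetaZeroSumsPsiErrorAssembly
import Literature.NumberTheory.LFunctions.ZetaZeroHarmonicSumTwoSided
import Literature.NumberTheory.LFunctions.ZetaZeroDensityExplicit
import Literature.NumberTheory.LFunctions.ExplicitZeroFreeRegionRoundsProofs
import HarnessLib

/-!
# RH-FREE — Johnston–Yang 2023, §3.2: the explicit bound `|ψ(x) − x|/x ≤ s₁(x,σ) + s₂(x,σ,K) + s₃(x)` (eqs. (3.2)–(3.8)) assembled in the kernel from zero statistics («nothing here bears on the truth of RH»)

Topic `Literature/NumberTheory/LFunctions` (RH literature-typing tranche 1, L4 "explicit zero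
statistics", gen 6). Label: **RH-FREE** (unconditional published material). ONE new named fact
(`JohnstonYang2023_lemma24`, D-0014: `def … : Prop`, nothing asserted, users take `(h : …)`), six
definitions transcribing the source's quantities, and THEOREMS. Nothing here bears on the truth of RH.

Johnston–Yang, J. Math. Anal. Appl. 527 (2023) 127460 = arXiv:2204.01980v2 (Zbl 1535.11128)
`[corpus:paper:arxiv-2204.01980 p0005 (Lemmas 2.4–2.7), p0007 (§3.2, eqs. (3.2)–(3.8))]`. Their
Theorem 1.1 / Table 1 (`|ψ(x) − x| ≤ A x (log x)^B exp(−C√log x)`, the named fact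
`JohnstonYang2023_table1'` of `PrimeNumberTheoremErrorTermExplicit.lean`) is computed in §3.2 from the
POINTWISE bound (3.7): for `x ≥ e^{2488}`, `T = exp(2√(log x/R₀))`, `σ ∈ [0.98, 1)`, `K ≥ 1`,

  `|ψ(x) − x|/x ≤ s₁(x,σ) + s₂(x,σ,K) + s₃(x)`,

with (3.3) `s₁(x,σ) = x^{−1/2} log²(H/2π)/(2π) + x^{σ−1}(log²(T/2π)/(2π) − log²(H/2π)/(2π) + 1.8642)`
(`H = 3 000 175 332 800`, Platt–Trudgian's RH height, their Lemma 2.1), (3.6)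
`s₂(x,σ,K) = 2 Σ_{k=0}^{K−1} (x^{−ν₁(t_k)}/t_k) N₀(σ,t_{k+1})`, `ν₁(t) = 1/(R₀ log t)`,
`t_k = exp((1 + k/K)√(log x/R₀))`, `N₀(σ,t) = C₁(σ) T^{8(1−σ)/3} log^{5−2σ} t + C₂(σ) log² t`
(Lemma 2.6 / Table 3), and (3.8) `s₃(x) = 4.3128 log^{0.6} x/T`. This file PROVES (3.7)
(`JohnstonYang2023_eq37`, for every row `(σ, C₁, C₂)` of Table 3, every `K ≥ 1`, every `x ≥ e^{2488}`)
from: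

* the NAMED FACT `JohnstonYang2023_lemma24` — **Lemma 2.4** (their form of Cully-Hugill–Johnston's
  truncated explicit formula, from the 2021 preprint of [CullyHugillJohnston2023] with an `ω`-column
  row not retained in the published Table 4, hence not derivable from the tree's
  `CullyHugillJohnston2023_table4'` / `CullyHugillJohnston2025_table1'`): for
  `max{50, log x} < T/1.8 < (x^{1/35} − 2)/4` and `x ≥ e^{1000}`,
  `|ψ(x) − x|/x ≤ Σ_{|Im ρ|≤T} x^{Re ρ−1}/|Im ρ| + 4.3128 log^{0.6}x/T`. In the tree's vocabulary the
  zero sum (non-trivial zeros with multiplicity, both signs of `Im ρ`, conjugate pairs) is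
  `FKS2023.zeroSumPsi 0 1 x T = 2Σ_{0<γ≤T} m(ρ) x^{β−1}/γ` (`ZetaZeroSumsPsiWeightLow.lean`; every
  non-trivial zero has `0 < β < 1`, `riemannZeta_ne_zero_of_one_le_re` and the functional equation);
* **Lemma 2.5** (`Σ_{0<γ≤T} 1/γ` two-sided) — a THEOREM of the tree modulo the named fact
  `BrentPlattTrudgian2022_lemma8` (`ZetaZeroHarmonicSumTwoSided.lean`: the lower half
  `log²(T/2π)/(4π) − 0.9321 ≤ Σ` is Saouter–Trudgian–Demichel's Lemma 2.10, proved fact-free);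
* **Lemma 2.1** = the named fact `platt_trudgian_numerical_rh` (`β = ½` for `0 < γ ≤ H`);
* **Lemma 2.6 / Table 3** = the named fact `JohnstonYang2023_table3` (`ZetaZeroDensityExplicit.lean`);
* **Lemma 2.7** (classical zero-free region, `R₀ = 5.5666305`) — implied by the tree's THEOREM
  `zero_free_region_mossinghoff_trudgian_yang_of_numerical_rh_only` (`R = 5.558691 ≤ R₀`, from
  `platt_trudgian_numerical_rh`);
* the staircase/partial-summation step (3.4)–(3.6) — Fiori–Kadiri–Swidinsky's Prop. 3.11 in the
  tree (`FioriKadiriSwidinsky2023_prop311`, `ZetaZeroSumsPsiWeightHigh.lean`), applied to the heights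
  `max(t₀^{FKS}, t_k)` and loosened to the printed `Σ_{k<K} w(t_k) N(σ, t_{k+1})`
  (`JY2023.zeroSumPsi_high_le_staircase`).

Proved, in order: `JY2023.zeroSumPsi_low_le_s₁` ((3.3): `Σ_{β<σ} ≤ s₁`), `JY2023.zeroSumPsi_high_le_staircase`
((3.4)–(3.5) with the true count `N(σ,·)`), `JY2023.zeroSumPsi_high_le_s₂` ((3.6)),
`JohnstonYang2023_eq37_of` ((3.7) for general `R`, split point `σ` and (ZDB)-input), and the printed
instance `JohnstonYang2023_eq37` (rows of Table 3, `R₀`, `x ≥ e^{2488}`; the conditions of Lemma 2.4 and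
`T > H` are discharged: `JY2023.lemma24_conditions`). Convention note: JY split the zeros as
`Re ρ ≤ σ` / `Re ρ > σ` and count `N(σ,T)` with `β > σ`; the tree's `zeroSumPsi a b` uses `a ≤ β < b`
and `zetaZeroCountRe` counts `β ≥ σ` — the printed (3.7) at a Table-3 abscissa `σ` is recovered by
applying the closed-convention bound at every `σ' ∈ (σ, 1)` (where Table 3 bounds the closed count,
`JohnstonYang2023_table3`) and letting `σ' ↓ σ` (`JohnstonYang2023_eq37`).

NOT formalized: the passage from (3.7) to Theorem 1.1/Table 1 ("`A'(x,σ,K)` is decreasing for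
`x ≥ x₀`", checked numerically in the source) and §3.3 (`X ≥ 10⁵`, the Ford-type region of Lemma 2.9).

## References

* D. R. Johnston, A. Yang, J. Math. Anal. Appl. 527 (2023) 127460 (arXiv:2204.01980v2), Lemmas
  2.1, 2.4–2.7, §3.2 eqs. (3.2)–(3.8). [JohnstonYang2023]
* A. Fiori, H. Kadiri, J. Swidinsky, J. Math. Anal. Appl. 527 (2023) 127426, Prop. 3.11 (the
  staircase). [FioriKadiriSwidinsky2023]
* R. P. Brent, D. J. Platt, T. S. Trudgian, J. Number Theory 238 (2022) 740–762, Lemma 8.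
  [BrentPlattTrudgian2022]
* Y. Saouter, T. Trudgian, P. Demichel, Math. Comp. 84 (2015) 2433–2446, Lemma 2.10.
  [SaouterTrudgianDemichel2015]
* M. J. Mossinghoff, T. S. Trudgian, A. Yang, Res. Number Theory 10 (2024), Thm. 1 (`R = 5.558691`).
  [MossinghoffTrudgianYangRNT2024]
* D. J. Platt, T. S. Trudgian, Bull. Lond. Math. Soc. 53 (2021) 792–797, Thm. 1. [PlattTrudgianBLMS2021]
-/

noncomputable section

open Complex Filter Set
open scoped Real Chebyshev Topology

namespace Literature.NumberTheory.LFunctions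

open SchoenfeldBound

/-! ## The source's quantities -/

namespace JY2023

/-- `R₀ = 5.5666305`, the classical zero-free-region constant of Lemma 2.7 (Mossinghoff–Trudgian 2015
with the RH height of Lemma 2.1). [cite: JohnstonYang2023, Lemma 2.7] -/
def R₀ : ℝ := 5.5666305

/-- The truncation height `T = exp(2√(log x/R₀))` of §3.2 (here with the constant `R` explicit).
[cite: JohnstonYang2023, §3.2 (before eq. (3.1))] -/
def T (R x : ℝ) : ℝ := Real.exp (2 * Real.sqrt (Real.log x / R))

/-- The heights `t_k = exp((1 + k/K)√(log x/R₀))`, `0 ≤ k ≤ K`, of §3.2 (so `t₀ = exp(√(log x/R₀))`,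
`t_K = T`). [cite: JohnstonYang2023, §3.2 (display before eq. (3.5))] -/
def tk (R x : ℝ) (K k : ℕ) : ℝ := Real.exp ((1 + (k : ℝ) / K) * Real.sqrt (Real.log x / R))

/-- **`s₁(x, σ)`** of eq. (3.3):
`x^{−1/2} log²(H/2π)/(2π) + x^{σ−1}(log²(T/2π)/(2π) − log²(H/2π)/(2π) + 1.8642)`, with the RH height
`H` and the truncation `T` explicit (in the source `H = 3 000 175 332 800`, `T = exp(2√(log x/R₀))`).
[cite: JohnstonYang2023, §3.2 eq. (3.3)] -/
def s₁ (H x σ T : ℝ) : ℝ :=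
  x ^ (-(1 / 2 : ℝ)) * (Real.log (H / (2 * π)) ^ 2 / (2 * π))
    + x ^ (σ - 1) * (Real.log (T / (2 * π)) ^ 2 / (2 * π) - Real.log (H / (2 * π)) ^ 2 / (2 * π) + 1.8642)

/-- **`N₀(σ, t) = C₁(σ) T^{8(1−σ)/3} log^{5−2σ} t + C₂(σ) log² t`**, "the upper bound for `N(σ, t_k)`
from Lemma 2.6" (with `T`, not `t`, in the power, as printed). [cite: JohnstonYang2023, §3.2 (before eq. (3.6))] -/
def N₀ (C₁ C₂ σ T t : ℝ) : ℝ :=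
  C₁ * T ^ (8 / 3 * (1 - σ)) * Real.log t ^ (5 - 2 * σ) + C₂ * Real.log t ^ 2

/-- **`s₂(x, σ, K) = 2 Σ_{k=0}^{K−1} (x^{−ν₁(t_k)}/t_k) N₀(σ, t_{k+1})`** of eq. (3.6), `ν₁(t) = 1/(R log t)`
(the weight is the tree's `FKS2023.zfrWeight R x t = x^{−1/(R log t)}/t`), with the zero-density
constants `C₁, C₂` and the zero-free-region constant `R` explicit. [cite: JohnstonYang2023, §3.2 eq. (3.6)] -/
def s₂ (C₁ C₂ R x σ : ℝ) (K : ℕ) : ℝ :=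
  2 * ∑ k ∈ Finset.range K, FKS2023.zfrWeight R x (tk R x K k) * N₀ C₁ C₂ σ (T R x) (tk R x K (k + 1))

/-- **`s₃(x) = 4.3128 log^{0.6} x / T`** of eq. (3.8) (the truncation error of Lemma 2.4).
[cite: JohnstonYang2023, §3.2 eq. (3.8)] -/
def s₃ (x T : ℝ) : ℝ := 4.3128 / T * Real.log x ^ (0.6 : ℝ)

end JY2023

/-! ## Lemma 2.4 (named fact) -/

/-- NAMED FACT (**Johnston–Yang 2023, Lemma 2.4**, as printed: "Let `T` and `x` be such that
`max{50, log x} < T/1.8 < (x^{1/35} − 2)/4`. Then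
`|ψ(x) − x|/x ≤ Σ_{|Im(ρ)|≤T} x^{Re(ρ)−1}/|Im(ρ)| + (4.3128/T) log^{0.6} x` for all `x ≥ exp(1000)`";
sum over the non-trivial zeros with multiplicity; source proof: the final row `(α, ω, M, x_M)` of the
table of the 2021 preprint of Cully-Hugill–Johnston, `T* ∈ [T/1.8, T]`, triangle inequality). In the
tree's vocabulary `Σ_{|Im ρ|≤T} x^{Re ρ−1}/|Im ρ| = 2Σ_{0<γ≤T} m(ρ) x^{β−1}/γ = FKS2023.zeroSumPsi 0 1 x T`
(conjugate pairs; every non-trivial zero has `0 < β < 1`), `ψ = Chebyshev.psi`, powers are `Real.rpow`.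
STATUS NOTE (no endorsement): the constant `4.3128` with the exponent `0.6` and the factor `1.8` rest on
a preprint table (arXiv:2111.10001v1–v2) whose published version (IJNT 2023, the tree's
`CullyHugillJohnston2023_table4'`) prints different parameters; the refereed source of THIS statement is
Johnston–Yang's Lemma 2.4 itself. Unconditional. Users take `(h : JohnstonYang2023_lemma24)`.
[cite: JohnstonYang2023, Lemma 2.4] -/
def JohnstonYang2023_lemma24 : Prop :=
  ∀ x T : ℝ, Real.exp 1000 ≤ x → 50 < T / 1.8 → Real.log x < T / 1.8 →
    T / 1.8 < (x ^ (1 / 35 : ℝ) - 2) / 4 →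
      |ψ x - x| / x ≤ FKS2023.zeroSumPsi 0 1 x T + 4.3128 / T * Real.log x ^ (0.6 : ℝ)

/-! ## Elementary facts about the heights -/

/-- `4πe ≤ H = 3 000 175 332 800` and `2π ≤ H`. [cite: JohnstonYang2023, Lemma 2.1] -/
theorem JY2023.four_pi_e_le_H₀ : 4 * π * Real.exp 1 ≤ JY2023.H₀ ∧ 2 * π ≤ JY2023.H₀ := by
  have hπ : π < 3.15 := Real.pi_lt_d2
  have hπ0 : 0 < π := Real.pi_pos
  have he : Real.exp 1 < 2.7182818286 := Real.exp_one_lt_d9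
  have he0 : 0 < Real.exp 1 := Real.exp_pos 1
  unfold JY2023.H₀
  constructor <;> nlinarith

/-- `t_0 = exp(√(log x/R))`. [cite: JohnstonYang2023, §3.2] -/
theorem JY2023.tk_zero (R x : ℝ) (K : ℕ) : JY2023.tk R x K 0 = Real.exp (Real.sqrt (Real.log x / R)) := by
  simp [JY2023.tk]

/-- `t_K = T` (`K ≥ 1`). [cite: JohnstonYang2023, §3.2] -/
theorem JY2023.tk_last (R x : ℝ) {K : ℕ} (hK : 1 ≤ K) : JY2023.tk R x K K = JY2023.T R x := by
  have hK0 : (K : ℝ) ≠ 0 := by exact_mod_cast (by omega : K ≠ 0)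
  unfold JY2023.tk JY2023.T
  rw [div_self hK0]; norm_num

/-- `k ↦ t_k` is non-decreasing. [cite: JohnstonYang2023, §3.2] -/
theorem JY2023.tk_mono (R x : ℝ) (K : ℕ) : Monotone (JY2023.tk R x K) := by
  intro i j hij
  unfold JY2023.tk
  refine Real.exp_le_exp.2 (mul_le_mul_of_nonneg_right ?_ (Real.sqrt_nonneg _))
  have : (i : ℝ) / K ≤ (j : ℝ) / K := div_le_div_of_nonneg_right (by exact_mod_cast hij) (Nat.cast_nonneg K)
  linarith

/-- `1 ≤ t_k`. [cite: JohnstonYang2023, §3.2] -/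
theorem JY2023.one_le_tk (R x : ℝ) (K k : ℕ) : 1 ≤ JY2023.tk R x K k := by
  unfold JY2023.tk
  exact Real.one_le_exp (mul_nonneg (by positivity) (Real.sqrt_nonneg _))

/-! ## No zeros with `β ≥ σ` below `H_σ` -/

/-- Under the numerical-RH fact and a zero-free region `σ ≥ 1 − 1/(R log|t|)` (`|t| ≥ 2`, `R > 0`):
`N(σ, H_σ) = 0` for `½ < σ < 1`, `H_σ = max(H₀, exp(1/(R(1−σ))))` (every zero with `β ≥ σ` has
`γ > H_σ`, `FKS2023.zfrHeight_lt_im`; JY: "since `N(σ, H) = 0`").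
[cite: JohnstonYang2023, §3.2 (after eq. (3.5))] [cite: FioriKadiriSwidinsky2023, §3.4 eq. (3.12)] -/
theorem zetaZeroCountRe_zfrHeight_eq_zero (hRH : platt_trudgian_numerical_rh) {R : ℝ} (hR : 0 < R)
    (hZFR : ∀ σ t : ℝ, 2 ≤ |t| → 1 - 1 / (R * Real.log |t|) ≤ σ → riemannZeta (σ + t * I) ≠ 0)
    {σ : ℝ} (hσ : 1 / 2 < σ) (hσ1 : σ < 1) :
    zetaZeroCountRe σ (FKS2023.zfrHeight R σ) = 0 := by
  have hempty : zetaZeroBox σ (FKS2023.zfrHeight R σ) = ∅ := by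
    ext ρ
    simp only [zetaZeroBox, Set.mem_setOf_eq, Set.mem_empty_iff_false, iff_false]
    rintro ⟨hz, hσρ, -, him, hle⟩
    exact absurd hle (not_le.2 (FKS2023.zfrHeight_lt_im hRH hR hZFR hσ hσ1 hz him hσρ))
  simp [zetaZeroCountRe, hempty]

/-! ## (3.3): the zeros with `β < σ` -/

/-- **JY (3.3)** (PROVED modulo the named facts `platt_trudgian_numerical_rh` — their Lemma 2.1 — and
`BrentPlattTrudgian2022_lemma8` — the upper half of their Lemma 2.5; the lower half is the tree's
theorem `log_sq_div_sub_le_sum_inv_ordinate`): for `x ≥ 1` and `T ≥ H = 3 000 175 332 800`,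
`2Σ_{0<γ≤T, β<σ} m(ρ) x^{β−1}/γ ≤ s₁(x,σ)`
`= x^{−1/2} log²(H/2π)/(2π) + x^{σ−1}(log²(T/2π)/(2π) − log²(H/2π)/(2π) + 1.8642)`
(zeros with `γ ≤ H` have `β = ½`; the others have `x^{β−1} ≤ x^{σ−1}` and
`Σ_{H<γ≤T} 1/γ ≤ log²(T/2π)/(4π) − log²(H/2π)/(4π) + 0.9321`).
[cite: JohnstonYang2023, §3.2 eq. (3.3)] -/
theorem JY2023.zeroSumPsi_low_le_s₁ (hRH : platt_trudgian_numerical_rh)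
    (h8 : BrentPlattTrudgian2022_lemma8) {σ x T : ℝ} (hx : 1 ≤ x) (hT : JY2023.H₀ ≤ T) :
    FKS2023.zeroSumPsi 0 σ x T ≤ JY2023.s₁ JY2023.H₀ x σ T := by
  classical
  obtain ⟨hH4, hH2⟩ := JY2023.four_pi_e_le_H₀
  have hHdef : JY2023.H₀ = 3000175332800 := rfl
  have hπ0 : 0 < π := Real.pi_pos
  have hx0 : 0 < x := by linarith
  have hH0 : (0 : ℝ) ≤ JY2023.H₀ := by rw [hHdef]; norm_num
  set H := JY2023.H₀ with hHset
  set Z := zerosBetween 0 T with hZ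
  set w : ℂ → ℝ := fun ρ ↦ (riemannZetaZeroOrder ρ : ℝ) * (1 / ρ.im) with hw
  have hw0 : ∀ {a b : ℝ}, 0 ≤ a → ∀ ρ ∈ zerosBetween a b, 0 ≤ w ρ := by
    intro a b ha ρ hρ
    have hm := zeroOrder_nonneg_of_mem_zerosBetween ha hρ
    obtain ⟨-, -, -, h3, -⟩ := (mem_zerosBetween ha).1 hρ
    have : 0 < ρ.im := ha.trans_lt h3
    simp only [hw]; exact mul_nonneg hm (by positivity)
  set F := Z.filter (fun ρ ↦ 0 ≤ ρ.re ∧ ρ.re < σ) with hF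
  set F₁ := F.filter (fun ρ ↦ ρ.im ≤ H) with hF₁
  set F₂ := F.filter (fun ρ ↦ ¬ ρ.im ≤ H) with hF₂
  -- the two harmonic sums
  set A := Real.log (H / (2 * π)) ^ 2 / (4 * π) with hA
  set B := Real.log (T / (2 * π)) ^ 2 / (4 * π) with hB
  have e8 : ∀ U : ℝ, ∑ ρ ∈ zerosBetween 0 U, (riemannZetaZeroOrder ρ : ℝ) / ρ.im =
      ∑ ρ ∈ zerosBetween 0 U, w ρ := fun U ↦ Finset.sum_congr rfl fun ρ _ ↦ by simp only [hw]; ring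
  have hSH : ∑ ρ ∈ zerosBetween 0 H, w ρ ≤ A := by rw [← e8]; exact h8 H hH4
  have hST : ∑ ρ ∈ zerosBetween 0 T, w ρ ≤ B := by rw [← e8]; exact h8 T (hH4.trans hT)
  have hSHlow : A - 0.9321 ≤ ∑ ρ ∈ zerosBetween 0 H, w ρ := log_sq_div_sub_le_sum_inv_ordinate hH2
  have hsplit := SoundTest.sum_zerosBetween_split le_rfl hH0 hT w
  have hSHT : ∑ ρ ∈ zerosBetween H T, w ρ ≤ B - A + 0.9321 := by linarith
  -- F₁ ⊆ zerosBetween 0 H, F₂ ⊆ zerosBetween H T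
  have hmemF : ∀ ρ ∈ F, riemannZeta ρ = 0 ∧ 0 ≤ ρ.re ∧ ρ.re ≤ 1 ∧ 0 < ρ.im ∧ ρ.im ≤ T ∧ ρ.re < σ := by
    intro ρ hρ
    rw [hF, Finset.mem_filter, hZ, mem_zerosBetween le_rfl] at hρ
    obtain ⟨⟨hz, h0, h1, him, hT'⟩, -, hσ'⟩ := hρ
    exact ⟨hz, h0, h1, him, hT', hσ'⟩
  have hF₁sub : F₁ ⊆ zerosBetween 0 H := by
    intro ρ hρ
    rw [hF₁, Finset.mem_filter] at hρ
    obtain ⟨hz, h0, h1, him, -, -⟩ := hmemF ρ hρ.1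
    exact (mem_zerosBetween le_rfl).2 ⟨hz, h0, h1, him, hρ.2⟩
  have hF₂sub : F₂ ⊆ zerosBetween H T := by
    intro ρ hρ
    rw [hF₂, Finset.mem_filter] at hρ
    obtain ⟨hz, h0, h1, -, hT', -⟩ := hmemF ρ hρ.1
    exact (mem_zerosBetween hH0).2 ⟨hz, h0, h1, not_le.1 hρ.2, hT'⟩
  have hS1 : ∑ ρ ∈ F₁, w ρ ≤ A :=
    (Finset.sum_le_sum_of_subset_of_nonneg hF₁sub fun ρ hρ _ ↦ hw0 le_rfl ρ hρ).trans hSH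
  have hS2 : ∑ ρ ∈ F₂, w ρ ≤ B - A + 0.9321 :=
    (Finset.sum_le_sum_of_subset_of_nonneg hF₂sub fun ρ hρ _ ↦ hw0 hH0 ρ hρ).trans hSHT
  -- pointwise weights
  have hxpow : ∀ ρ ∈ F, (riemannZetaZeroOrder ρ : ℝ) * (x ^ (ρ.re - 1) / ρ.im) = x ^ (ρ.re - 1) * w ρ := by
    intro ρ _; simp only [hw]; ring
  have hF₁le : ∑ ρ ∈ F₁, x ^ (ρ.re - 1) * w ρ = x ^ (-(1 / 2 : ℝ)) * ∑ ρ ∈ F₁, w ρ := by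
    rw [Finset.mul_sum]
    refine Finset.sum_congr rfl fun ρ hρ ↦ ?_
    rw [hF₁, Finset.mem_filter] at hρ
    obtain ⟨hz, -, -, him, -, -⟩ := hmemF ρ hρ.1
    have hβ : ρ.re = 1 / 2 := hRH ρ hz him (by rw [hHdef] at hρ; exact hρ.2)
    rw [hβ]; norm_num
  have hF₂le : ∑ ρ ∈ F₂, x ^ (ρ.re - 1) * w ρ ≤ x ^ (σ - 1) * ∑ ρ ∈ F₂, w ρ := by
    rw [Finset.mul_sum]
    refine Finset.sum_le_sum fun ρ hρ ↦ ?_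
    have hρF : ρ ∈ F := (Finset.mem_filter.1 hρ).1
    obtain ⟨-, -, -, -, -, hσ'⟩ := hmemF ρ hρF
    refine mul_le_mul_of_nonneg_right ?_ (hw0 le_rfl ρ (Finset.mem_filter.1 hρF).1)
    exact Real.rpow_le_rpow_of_exponent_le hx (by linarith)
  have hxa : 0 ≤ x ^ (-(1 / 2 : ℝ)) := Real.rpow_nonneg hx0.le _
  have hxb : 0 ≤ x ^ (σ - 1) := Real.rpow_nonneg hx0.le _
  -- assemble
  unfold FKS2023.zeroSumPsi JY2023.s₁
  rw [← hZ, ← hF, Finset.sum_congr rfl hxpow, ← Finset.sum_filter_add_sum_filter_not F (fun ρ ↦ ρ.im ≤ H),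
    ← hF₁, ← hF₂, hF₁le]
  have h1 : x ^ (-(1 / 2 : ℝ)) * ∑ ρ ∈ F₁, w ρ ≤ x ^ (-(1 / 2 : ℝ)) * A := mul_le_mul_of_nonneg_left hS1 hxa
  have h2 : x ^ (σ - 1) * ∑ ρ ∈ F₂, w ρ ≤ x ^ (σ - 1) * (B - A + 0.9321) :=
    mul_le_mul_of_nonneg_left hS2 hxb
  have eA : Real.log (H / (2 * π)) ^ 2 / (2 * π) = 2 * A := by rw [hA]; field_simp; ring
  have eB : Real.log (T / (2 * π)) ^ 2 / (2 * π) = 2 * B := by rw [hB]; field_simp; ring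
  rw [eA, eB]
  nlinarith [hF₂le, h1, h2]

/-! ## (3.4)–(3.5): the staircase for the zeros with `β ≥ σ` -/

/-- **JY (3.4)–(3.5) with the true count** (PROVED): under the numerical-RH fact and a zero-free region
`σ ≥ 1 − 1/(R log|t|)` (`|t| ≥ 2`, `R > 0`), for `½ < σ < 1`, `x ≥ 1`, `K ≥ 1` and heights
`exp(√(log x/R)) = t_0 ≤ t_1 ≤ … ≤ t_K`,
`2Σ_{0<γ≤t_K, β≥σ} m(ρ) x^{β−1}/γ ≤ 2 Σ_{k=0}^{K−1} w(t_k) N(σ, t_{k+1})`, `w(t) = x^{−1/(R log t)}/t`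
(the printed `2∫_H^T w dN ≤ 2(Σ_{k<K} w(t_k) N(σ,t_{k+1}) − w(t_0)N(σ,t_0)) + 2w(t_0)N(σ,t_0)`: each zero
has `x^{β−1}/γ ≤ w(γ) ≤ w(t_k)` for the last `t_k ≤ γ`, `w` increasing up to `t_0` and decreasing
after). Obtained from the tree's FKS Prop. 3.11 (`FioriKadiriSwidinsky2023_prop311`) at the heights
`max(t₀^{FKS}, t_k)`, `t₀^{FKS} = max(H_σ, t_0)`, followed by Abel summation and `N(σ, H_σ) = 0`.
[cite: JohnstonYang2023, §3.2 eqs. (3.4)–(3.5)] [cite: FioriKadiriSwidinsky2023, Prop. 3.11] -/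
theorem JY2023.zeroSumPsi_high_le_staircase (hRH : platt_trudgian_numerical_rh) {R : ℝ} (hR : 0 < R)
    (hZFR : ∀ σ t : ℝ, 2 ≤ |t| → 1 - 1 / (R * Real.log |t|) ≤ σ → riemannZeta (σ + t * I) ≠ 0)
    {σ : ℝ} (hσ : 1 / 2 < σ) (hσ1 : σ < 1) {x : ℝ} (hx : 1 ≤ x) {K : ℕ} (hK : 1 ≤ K) {t : ℕ → ℝ}
    (ht0 : t 0 = Real.exp (Real.sqrt (Real.log x / R))) (hmono : Monotone t) :
    FKS2023.zeroSumPsi σ 1 x (t K) ≤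
      2 * ∑ k ∈ Finset.range K, FKS2023.zfrWeight R x (t k) * (zetaZeroCountRe σ (t (k + 1)) : ℝ) := by
  classical
  have hx0 : 0 < x := by linarith
  set t₀F := FKS2023.t₀ R σ x with ht₀F
  have hH₀ : FKS2023.H₀ = 3 * 10 ^ 12 := rfl
  have ht₀F0 : 0 ≤ t₀F := le_trans (by rw [hH₀]; norm_num) (FKS2023.H₀_le_t₀ R σ x)
  have het₀ : Real.exp (Real.sqrt (Real.log x / R)) ≤ t₀F := le_max_right _ _
  -- the shifted heights
  set t' : ℕ → ℝ := fun k ↦ max t₀F (t k) with ht'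
  have ht'0 : t' 0 = FKS2023.t₀ R σ x := by simp only [ht', ht0]; exact max_eq_left het₀
  have hmono' : Monotone t' := fun i j hij ↦ max_le_max le_rfl (hmono hij)
  have htk0 : ∀ k, Real.exp (Real.sqrt (Real.log x / R)) ≤ t k := fun k ↦ ht0 ▸ hmono (Nat.zero_le k)
  have htk_pos : ∀ k, 0 ≤ t k := fun k ↦ (Real.exp_pos _).le.trans (htk0 k)
  set w : ℕ → ℝ := fun k ↦ FKS2023.zfrWeight R x (t' k) with hw
  have hw0 : ∀ k, 0 ≤ w k := fun k ↦ FKS2023.zfrWeight_nonneg hx0.le (ht₀F0.trans (le_max_left _ _))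
  -- FKS Prop. 3.11 at the shifted heights, `T = t K`
  have h311 := FioriKadiriSwidinsky2023_prop311 hRH hR hZFR hσ hx hK ht'0 hmono' (t K)
  -- the counts, with `N_K = N(σ, t_K)`
  set M : ℕ → ℝ := fun j ↦ if j = K then (zetaZeroCountRe σ (t K) : ℝ) else (zetaZeroCountRe σ (t' j) : ℝ)
    with hM
  have hM0 : ∀ j, 0 ≤ M j := fun j ↦ by simp only [hM]; split_ifs <;> exact Nat.cast_nonneg _
  have hMK : M K = zetaZeroCountRe σ (t K) := by simp [hM]
  have hMlt : ∀ j < K, M j = zetaZeroCountRe σ (t' j) := fun j hj ↦ by simp [hM, ne_of_lt hj]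
  have hrew : ∑ k ∈ Finset.Ico 1 K, (zetaZeroCountRe σ (t' k) : ℝ) *
        (FKS2023.zfrWeight R x (t' (k - 1)) - FKS2023.zfrWeight R x (t' k))
        + FKS2023.zfrWeight R x (t' (K - 1)) * zetaZeroCountRe σ (t K) =
      ∑ k ∈ Finset.Ico 1 K, M k * (w (k - 1) - w k) + w (K - 1) * M K := by
    rw [hMK]
    congr 1
    refine Finset.sum_congr rfl fun k hk ↦ ?_
    rw [hMlt k (Finset.mem_Ico.1 hk).2]
  have habel := FKS2023.abel_shift M w hK
  -- drop the negative terms and re-index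
  have hdrop : ∑ k ∈ Finset.Ico 1 K, w k * (M (k + 1) - M k) + M 1 * w 0 ≤
      ∑ k ∈ Finset.range K, w k * M (k + 1) := by
    rw [Finset.range_eq_Ico, Finset.sum_eq_sum_Ico_succ_bot hK, zero_add]
    have : ∑ k ∈ Finset.Ico 1 K, w k * (M (k + 1) - M k) ≤ ∑ k ∈ Finset.Ico 1 K, w k * M (k + 1) :=
      Finset.sum_le_sum fun k _ ↦ by nlinarith [hw0 k, hM0 k]
    linarith [mul_comm (M 1) (w 0)]
  -- compare with the printed heights
  have hterm : ∀ k ∈ Finset.range K, w k * M (k + 1) ≤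
      FKS2023.zfrWeight R x (t k) * (zetaZeroCountRe σ (t (k + 1)) : ℝ) := by
    intro k hk
    have hkK : k < K := Finset.mem_range.1 hk
    have hwk : w k ≤ FKS2023.zfrWeight R x (t k) :=
      FKS2023.zfrWeight_le_of_le hR hx (htk0 k) (le_max_right _ _)
    have hMk : M (k + 1) ≤ zetaZeroCountRe σ (t (k + 1)) := by
      rcases eq_or_lt_of_le (Nat.succ_le_of_lt hkK) with h | h
      · have h' : k + 1 = K := h
        rw [h', hMK]
      · rw [hMlt (k + 1) h]
        simp only [ht']
        rcases le_total t₀F (t (k + 1)) with hle | hle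
        · rw [max_eq_right hle]
        · rw [max_eq_left hle]
          rcases le_total (FKS2023.zfrHeight R σ) (Real.exp (Real.sqrt (Real.log x / R))) with h1 | h1
          · -- here `t₀F = t_0 = t_{k+1}`
            have e1 : t₀F = Real.exp (Real.sqrt (Real.log x / R)) := by
              rw [ht₀F]; exact max_eq_right h1
            have e2 : t₀F = t (k + 1) := le_antisymm (by rw [e1]; exact htk0 (k + 1)) hle
            rw [e2]
          · -- here `t₀F = H_σ` and `N(σ, H_σ) = 0`
            have e1 : t₀F = FKS2023.zfrHeight R σ := by
              rw [ht₀F]; exact max_eq_left h1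
            rw [e1, zetaZeroCountRe_zfrHeight_eq_zero hRH hR hZFR hσ hσ1, Nat.cast_zero]
            exact Nat.cast_nonneg _
    exact mul_le_mul hwk hMk (hM0 _) (FKS2023.zfrWeight_nonneg hx0.le (htk_pos k))
  have hsum := Finset.sum_le_sum hterm
  rw [hrew, habel] at h311
  linarith

/-- **JY (3.5) ⟹ (3.6) with any (ZDB) majorant** (PROVED): if moreover `N(σ, u) ≤ Ñ(u)` for all
`u ≥ 1`, then `2Σ_{0<γ≤t_K, β≥σ} m(ρ) x^{β−1}/γ ≤ 2 Σ_{k<K} w(t_k) Ñ(t_{k+1})` (heights `t_k ≥ 1`).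
[cite: JohnstonYang2023, §3.2 eq. (3.6)] -/
theorem JY2023.zeroSumPsi_high_le_of_majorant (hRH : platt_trudgian_numerical_rh) {R : ℝ} (hR : 0 < R)
    (hZFR : ∀ σ t : ℝ, 2 ≤ |t| → 1 - 1 / (R * Real.log |t|) ≤ σ → riemannZeta (σ + t * I) ≠ 0)
    {σ : ℝ} (hσ : 1 / 2 < σ) (hσ1 : σ < 1) {x : ℝ} (hx : 1 ≤ x) {K : ℕ} (hK : 1 ≤ K) {t : ℕ → ℝ}
    (ht0 : t 0 = Real.exp (Real.sqrt (Real.log x / R))) (hmono : Monotone t) {Ntilde : ℝ → ℝ}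
    (hN : ∀ u : ℝ, 1 ≤ u → (zetaZeroCountRe σ u : ℝ) ≤ Ntilde u) :
    FKS2023.zeroSumPsi σ 1 x (t K) ≤
      2 * ∑ k ∈ Finset.range K, FKS2023.zfrWeight R x (t k) * Ntilde (t (k + 1)) := by
  have hx0 : 0 < x := by linarith
  have h := JY2023.zeroSumPsi_high_le_staircase hRH hR hZFR hσ hσ1 hx hK ht0 hmono
  have h1 : ∀ k, 1 ≤ t k := fun k ↦
    (Real.one_le_exp (Real.sqrt_nonneg _)).trans (ht0 ▸ hmono (Nat.zero_le k))
  have hsum : ∑ k ∈ Finset.range K, FKS2023.zfrWeight R x (t k) * (zetaZeroCountRe σ (t (k + 1)) : ℝ) ≤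
      ∑ k ∈ Finset.range K, FKS2023.zfrWeight R x (t k) * Ntilde (t (k + 1)) :=
    Finset.sum_le_sum fun k _ ↦ mul_le_mul_of_nonneg_left (hN _ (h1 _))
      (FKS2023.zfrWeight_nonneg hx0.le (zero_le_one.trans (h1 k)))
  linarith

/-! ## (3.6): `Σ_{β ≥ σ} ≤ s₂(x, σ, K)` -/

/-- `Ñ(σ', t) ≤ N₀(σ', t)` for `1 ≤ t ≤ T`: the Ingham–KLN shape `C₁ t^{8(1−σ')/3}(log t)^{5−2σ'} + C₂ log²t`
is at most the printed `N₀` with `T` in the power (`C₁ ≥ 0`, `σ' ≤ 1`).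
[cite: JohnstonYang2023, §3.2 (before eq. (3.6))] -/
theorem JY2023.inghamBound_le_N₀ {C₁ C₂ σ' t T : ℝ} (hC₁ : 0 ≤ C₁) (hσ' : σ' ≤ 1) (ht : 1 ≤ t)
    (htT : t ≤ T) : inghamBound C₁ C₂ σ' t ≤ JY2023.N₀ C₁ C₂ σ' T t := by
  unfold inghamBound JY2023.N₀
  have hlog : 0 ≤ Real.log t := Real.log_nonneg ht
  have hpow : t ^ (8 / 3 * (1 - σ')) ≤ T ^ (8 / 3 * (1 - σ')) :=
    Real.rpow_le_rpow (by linarith) htT (by nlinarith)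
  have hq : 0 ≤ Real.log t ^ (5 - 2 * σ') := Real.rpow_nonneg hlog _
  nlinarith [mul_le_mul_of_nonneg_left hpow hC₁]

/-- **JY (3.6)** (PROVED): under the numerical-RH fact, a zero-free region with constant `R > 0`, and a
zero-density bound `N(σ, u) ≤ C₁ u^{8(1−σ')/3}(log u)^{5−2σ'} + C₂ log²u` for all `u ≥ 1`
(`C₁ ≥ 0`, `σ' ≤ 1`; e.g. Table 3 at an abscissa `σ' < σ`), for `½ < σ < 1`, `x ≥ 1`, `K ≥ 1`:
`2Σ_{0<γ≤T, β≥σ} m(ρ) x^{β−1}/γ ≤ s₂ = 2Σ_{k<K} (x^{−1/(R log t_k)}/t_k) N₀(σ', t_{k+1})`,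
`T = exp(2√(log x/R)) = t_K`. [cite: JohnstonYang2023, §3.2 eq. (3.6)] -/
theorem JY2023.zeroSumPsi_high_le_s₂ (hRH : platt_trudgian_numerical_rh) {R : ℝ} (hR : 0 < R)
    (hZFR : ∀ σ t : ℝ, 2 ≤ |t| → 1 - 1 / (R * Real.log |t|) ≤ σ → riemannZeta (σ + t * I) ≠ 0)
    {σ σ' C₁ C₂ : ℝ} (hσ : 1 / 2 < σ) (hσ1 : σ < 1) (hC₁ : 0 ≤ C₁) (hσ' : σ' ≤ 1)
    (hN : ∀ u : ℝ, 1 ≤ u → (zetaZeroCountRe σ u : ℝ) ≤ inghamBound C₁ C₂ σ' u)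
    {x : ℝ} (hx : 1 ≤ x) {K : ℕ} (hK : 1 ≤ K) :
    FKS2023.zeroSumPsi σ 1 x (JY2023.T R x) ≤ JY2023.s₂ C₁ C₂ R x σ' K := by
  have hx0 : 0 < x := by linarith
  have h := JY2023.zeroSumPsi_high_le_of_majorant hRH hR hZFR hσ hσ1 hx hK (JY2023.tk_zero R x K)
    (JY2023.tk_mono R x K) hN
  rw [JY2023.tk_last R x hK] at h
  unfold JY2023.s₂
  refine h.trans (mul_le_mul_of_nonneg_left (Finset.sum_le_sum fun k hk ↦ ?_) (by norm_num))
  have hkK : k + 1 ≤ K := Nat.succ_le_of_lt (Finset.mem_range.1 hk)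
  refine mul_le_mul_of_nonneg_left ?_ (FKS2023.zfrWeight_nonneg hx0.le (zero_le_one.trans (JY2023.one_le_tk R x K k)))
  refine JY2023.inghamBound_le_N₀ hC₁ hσ' (JY2023.one_le_tk R x K (k + 1)) ?_
  rw [← JY2023.tk_last R x hK]
  exact JY2023.tk_mono R x K hkK

/-! ## (3.7) -/

/-- **JY (3.7), general form** (PROVED modulo the named facts `JohnstonYang2023_lemma24`,
`BrentPlattTrudgian2022_lemma8`, `platt_trudgian_numerical_rh`; the zero-free region and the (ZDB)
bound are hypotheses): for `½ < σ < 1`, `x ≥ e^{1000}` with `T = exp(2√(log x/R)) ≥ H` in the range of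
Lemma 2.4, and `K ≥ 1`,
`|ψ(x) − x|/x ≤ s₁(x,σ) + s₂(x,σ',K) + s₃(x)`.
[cite: JohnstonYang2023, §3.2 eq. (3.7)] -/
theorem JohnstonYang2023_eq37_of (h24 : JohnstonYang2023_lemma24) (h8 : BrentPlattTrudgian2022_lemma8)
    (hRH : platt_trudgian_numerical_rh) {R : ℝ} (hR : 0 < R)
    (hZFR : ∀ σ t : ℝ, 2 ≤ |t| → 1 - 1 / (R * Real.log |t|) ≤ σ → riemannZeta (σ + t * I) ≠ 0)
    {σ σ' C₁ C₂ : ℝ} (hσ : 1 / 2 < σ) (hσ1 : σ < 1) (hC₁ : 0 ≤ C₁) (hσ' : σ' ≤ 1)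
    (hN : ∀ u : ℝ, 1 ≤ u → (zetaZeroCountRe σ u : ℝ) ≤ inghamBound C₁ C₂ σ' u)
    {K : ℕ} (hK : 1 ≤ K) {x : ℝ} (hx : Real.exp 1000 ≤ x) (h50 : 50 < JY2023.T R x / 1.8)
    (hlog : Real.log x < JY2023.T R x / 1.8) (h35 : JY2023.T R x / 1.8 < (x ^ (1 / 35 : ℝ) - 2) / 4)
    (hHT : JY2023.H₀ ≤ JY2023.T R x) :
    |ψ x - x| / x ≤ JY2023.s₁ JY2023.H₀ x σ (JY2023.T R x) + JY2023.s₂ C₁ C₂ R x σ' K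
      + JY2023.s₃ x (JY2023.T R x) := by
  have hx1 : 1 ≤ x := le_trans (Real.one_le_exp (by norm_num)) hx
  have h1 := h24 x (JY2023.T R x) hx h50 hlog h35
  have hsplit : FKS2023.zeroSumPsi 0 1 x (JY2023.T R x) =
      FKS2023.zeroSumPsi 0 σ x (JY2023.T R x) + FKS2023.zeroSumPsi σ 1 x (JY2023.T R x) :=
    (FKS2023.zeroSumPsi_add (by linarith) hσ1.le x (JY2023.T R x)).symm
  have h2 := JY2023.zeroSumPsi_low_le_s₁ hRH h8 (σ := σ) hx1 hHT
  have h3 := JY2023.zeroSumPsi_high_le_s₂ hRH hR hZFR hσ hσ1 hC₁ hσ' hN hx1 hK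
  unfold JY2023.s₃
  rw [hsplit] at h1
  linarith

/-! ## The printed instance: Table 3 rows, `R₀ = 5.5666305`, `x ≥ e^{2488}` -/

/-- Every Table-3 abscissa satisfies `σ < 1` (indeed `σ ≤ 0.999`). [cite: JohnstonYang2023, Table 3] -/
theorem JY2023.table3_lt_one : ∀ p ∈ JY2023.table3, p.1 < 1 := by
  intro p hp
  simp only [JY2023.table3, List.mem_cons, List.mem_nil_iff, or_false] at hp
  rcases hp with rfl | rfl | rfl | rfl | rfl | rfl | rfl | rfl | rfl | rfl | rfl | rfl | rfl | rfl |
    rfl | rfl | rfl | rfl | rfl | rfl <;> norm_num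

/-- The zero-free region of Lemma 2.7 (`R₀ = 5.5666305`) from the tree's Mossinghoff–Trudgian–Yang
theorem (`R = 5.558691 ≤ R₀`, proved from `platt_trudgian_numerical_rh`): a smaller constant gives a
wider region. [cite: JohnstonYang2023, Lemma 2.7] [cite: MossinghoffTrudgianYangRNT2024, Theorem 1] -/
theorem JY2023.zeroFreeRegion_R₀ (hRH : platt_trudgian_numerical_rh) :
    ∀ σ t : ℝ, 2 ≤ |t| → 1 - 1 / (JY2023.R₀ * Real.log |t|) ≤ σ → riemannZeta (σ + t * I) ≠ 0 := by
  intro σ t ht hσ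
  refine zero_free_region_mossinghoff_trudgian_yang_of_numerical_rh_only hRH σ t ht (le_trans ?_ hσ)
  have hlog : 0 < Real.log |t| := Real.log_pos (by linarith)
  unfold JY2023.R₀
  have h1 : 0 < 5.558691 * Real.log |t| := by positivity
  have h2 : 5.558691 * Real.log |t| ≤ 5.5666305 * Real.log |t| := by nlinarith
  linarith [one_div_le_one_div_of_le h1 h2]

/-- **The side conditions at `x ≥ e^{2488}`** ("since `x ≥ exp(2488)`, we have `T > H`", and the range
of Lemma 2.4): with `T = exp(2√(log x/R₀))`, `50 < T/1.8`, `log x < T/1.8`, `T/1.8 < (x^{1/35} − 2)/4`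
and `H ≤ T`. [cite: JohnstonYang2023, §3.2 (after eq. (3.3))] -/
theorem JY2023.lemma24_conditions {x : ℝ} (hx : Real.exp 2488 ≤ x) :
    50 < JY2023.T JY2023.R₀ x / 1.8 ∧ Real.log x < JY2023.T JY2023.R₀ x / 1.8 ∧
      JY2023.T JY2023.R₀ x / 1.8 < (x ^ (1 / 35 : ℝ) - 2) / 4 ∧ JY2023.H₀ ≤ JY2023.T JY2023.R₀ x := by
  have hR : JY2023.R₀ = 5.5666305 := rfl
  have hH : JY2023.H₀ = 3000175332800 := rfl
  have hx0 : 0 < x := (Real.exp_pos _).trans_le hx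
  set L := Real.log x with hL
  have hL2488 : 2488 ≤ L := by
    rw [hL, ← Real.log_exp 2488]; exact Real.log_le_log (Real.exp_pos _) hx
  set u := Real.sqrt (L / JY2023.R₀) with hu
  have hu0 : 0 ≤ u := Real.sqrt_nonneg _
  have hLu : L = JY2023.R₀ * u ^ 2 := by
    rw [hu, Real.sq_sqrt (div_nonneg (by linarith) (by rw [hR]; norm_num)), hR]; field_simp
  have hu21 : 21 ≤ u := by
    rw [hR] at hLu
    nlinarith
  have hT : JY2023.T JY2023.R₀ x = Real.exp (2 * u) := rfl
  -- `T ≥ e^{42} ≥ 2^{42}`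
  have he2 : (2 : ℝ) ≤ Real.exp 1 := by have := Real.add_one_le_exp (1 : ℝ); norm_num at this; linarith
  have hT42 : (2 : ℝ) ^ 42 ≤ JY2023.T JY2023.R₀ x := by
    rw [hT]
    calc (2 : ℝ) ^ 42 ≤ Real.exp 1 ^ 42 := by gcongr
      _ = Real.exp 42 := by rw [← Real.exp_nat_mul]; norm_num
      _ ≤ Real.exp (2 * u) := Real.exp_le_exp.2 (by linarith)
  have hTpos : 0 < JY2023.T JY2023.R₀ x := Real.exp_pos _
  refine ⟨?_, ?_, ?_, ?_⟩
  · rw [lt_div_iff₀ (by norm_num)]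
    linarith [show (90 : ℝ) < 2 ^ 42 by norm_num]
  · -- `log x = R₀u² < e^{2u}/1.8` since `e^{2u} ≥ (2u)⁴/24`
    rw [lt_div_iff₀ (by norm_num), hT]
    have h4 := Real.pow_div_factorial_le_exp (2 * u) (by linarith) 4
    have hfac : ((Nat.factorial 4 : ℕ) : ℝ) = 24 := by norm_num [Nat.factorial]
    rw [hfac] at h4
    rw [hLu, hR]
    nlinarith
  · -- `x^{1/35} = e^{L/35} ≥ e^{2u+1} = e·T`
    have hx35 : x ^ (1 / 35 : ℝ) = Real.exp (L / 35) := by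
      rw [Real.rpow_def_of_pos hx0, hL]; ring_nf
    have hexp : Real.exp (2 * u + 1) ≤ Real.exp (L / 35) := by
      refine Real.exp_le_exp.2 ?_
      rw [hLu, hR]
      nlinarith [mul_nonneg (sub_nonneg.2 hu21) hu0]
    rw [Real.exp_add, ← hT] at hexp
    have he27 : 2.7182818283 < Real.exp 1 := Real.exp_one_gt_d9
    rw [hx35, div_lt_div_iff₀ (by norm_num) (by norm_num)]
    nlinarith [he27, show (90 : ℝ) < 2 ^ 42 by norm_num]
  · rw [hH]
    linarith [show (3000175332800 : ℝ) ≤ 2 ^ 42 by norm_num]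

/-- **Johnston–Yang 2023, eq. (3.7)** (PROVED modulo the named facts `JohnstonYang2023_lemma24`
(Lemma 2.4), `BrentPlattTrudgian2022_lemma8` (Lemma 2.5, upper half), `platt_trudgian_numerical_rh`
(Lemma 2.1) and `JohnstonYang2023_table3` (Lemma 2.6); Lemma 2.7 and the staircase are theorems of the
tree): for every row `(σ, C₁(σ), C₂(σ))` of Table 3, every `K ≥ 1` and every `x ≥ e^{2488}`, with
`T = exp(2√(log x/R₀))`, `R₀ = 5.5666305`, `H = 3 000 175 332 800`,
`|ψ(x) − x|/x ≤ s₁(x,σ) + s₂(x,σ,K) + s₃(x)`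
(`s₁` (3.3), `s₂` (3.6) with `N₀(σ,t) = C₁(σ)T^{8(1−σ)/3}log^{5−2σ}t + C₂(σ)log²t`, `s₃` (3.8)). The
closed/open convention at `β = σ` is immaterial: the bound is obtained at every `σ' ∈ (σ,1)` and
`σ' ↓ σ`. [cite: JohnstonYang2023, §3.2 eq. (3.7)] -/
theorem JohnstonYang2023_eq37 (h24 : JohnstonYang2023_lemma24) (h8 : BrentPlattTrudgian2022_lemma8)
    (hRH : platt_trudgian_numerical_rh) (h3 : JohnstonYang2023_table3) {σ C₁ C₂ : ℝ}
    (hrow : (σ, C₁, C₂) ∈ JY2023.table3) {K : ℕ} (hK : 1 ≤ K) {x : ℝ} (hx : Real.exp 2488 ≤ x) :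
    |ψ x - x| / x ≤ JY2023.s₁ JY2023.H₀ x σ (JY2023.T JY2023.R₀ x)
      + JY2023.s₂ C₁ C₂ JY2023.R₀ x σ K + JY2023.s₃ x (JY2023.T JY2023.R₀ x) := by
  obtain ⟨hσ, hC₁, -⟩ := JY2023.table3_pos _ hrow
  have hσ1 : σ < 1 := JY2023.table3_lt_one _ hrow
  have hR0 : 0 < JY2023.R₀ := by unfold JY2023.R₀; norm_num
  have hx1000 : Real.exp 1000 ≤ x := le_trans (Real.exp_le_exp.2 (by norm_num)) hx
  have hx0 : 0 < x := (Real.exp_pos _).trans_le hx1000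
  obtain ⟨h50, hlog, h35, hHT⟩ := JY2023.lemma24_conditions hx
  set Tx := JY2023.T JY2023.R₀ x with hTx
  -- the bound at every σ' ∈ (σ, 1)
  have hσ' : ∀ σ' : ℝ, σ < σ' → σ' < 1 →
      |ψ x - x| / x ≤ JY2023.s₁ JY2023.H₀ x σ' Tx + JY2023.s₂ C₁ C₂ JY2023.R₀ x σ K + JY2023.s₃ x Tx := by
    intro σ' h1 h2
    exact JohnstonYang2023_eq37_of h24 h8 hRH hR0 (JY2023.zeroFreeRegion_R₀ hRH) (hσ.trans h1) h2 hC₁.le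
      hσ1.le (fun u hu ↦ h3.of_one_le hRH hrow h1 hu) hK hx1000 h50 hlog h35 hHT
  -- let σ' ↓ σ
  set a := x ^ (-(1 / 2 : ℝ)) * (Real.log (JY2023.H₀ / (2 * π)) ^ 2 / (2 * π)) with ha
  set c := Real.log (Tx / (2 * π)) ^ 2 / (2 * π) - Real.log (JY2023.H₀ / (2 * π)) ^ 2 / (2 * π) + 1.8642
    with hc
  set b := JY2023.s₂ C₁ C₂ JY2023.R₀ x σ K + JY2023.s₃ x Tx with hb
  have hs₁ : ∀ s : ℝ, JY2023.s₁ JY2023.H₀ x s Tx = a + x ^ (s - 1) * c := fun s ↦ rfl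
  set g : ℝ → ℝ := fun s ↦ a + x ^ (s - 1) * c + b with hg
  have hgcont : ContinuousAt g σ := by
    have h1 : ContinuousAt (fun s : ℝ ↦ x ^ (s - 1)) σ :=
      (Real.continuousAt_const_rpow hx0.ne').comp (continuousAt_id.sub continuousAt_const)
    exact (continuousAt_const.add (h1.mul continuousAt_const)).add continuousAt_const
  have htend : Tendsto g (𝓝[>] σ) (𝓝 (g σ)) := hgcont.continuousWithinAt.tendsto
  have hev : ∀ᶠ s in 𝓝[>] σ, |ψ x - x| / x ≤ g s := by
    have h1 : ∀ᶠ s in 𝓝[>] σ, s < 1 := eventually_nhdsWithin_of_eventually_nhds (Iio_mem_nhds hσ1)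
    have h2 : ∀ᶠ s in 𝓝[>] σ, σ < s := self_mem_nhdsWithin
    filter_upwards [h1, h2] with s hs1 hs2
    have := hσ' s hs2 hs1
    rw [hs₁] at this
    simpa only [hg, hb, add_assoc] using this
  have := ge_of_tendsto htend hev
  rw [hs₁]
  simpa only [hg, hb, add_assoc] using this

end Literature.NumberTheory.LFunctions

end
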